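import Summits.CriticalPhenomena.CardyFormulaZ2.Theorems.CardyIKTransportIKMixedBoxCrossingDefs2
import Mathlib.Probability.Independence.InfinitePi
import Mathlib.Probability.Moments.Variance

/-!
# Mirror, parts (a)–(d): the bit maps `Θ₀`, `Φ₀` preserve `μIK` and act on observables by `reflObs` / `reflObs ∘ complObs`

Helper file of the line `paired-mirror-exploration` for the crux `IKMixedBoxCrossing` (stmt-CriticalPhenomena-5911, lead
prover-line-stmt-CriticalPhenomena-5911-0), toward the registered stub `stub_mirror : Mirror` (reflection positivity of the
column-mixed IK gauge in the cell row `0`, EVERY pattern `S`).  Vocabulary: `Theorems/CardyIKTransportIKMixedBoxCrossingDefs2.lean`.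
-/

noncomputable section

namespace Summit.CriticalPhenomena.CardyFormulaZ2.Cruxes.IKMixedBoxCrossing.PairedMirrorExploration

open scoped Classical
open MeasureTheory ProbabilityTheory Set
open Literature.Probability.Percolation Literature.Probability.LatticeModels
open Summit.CriticalPhenomena.CardyFormulaZ2.Theorems.IKLinearTransport.PinnedDiagramExchange
open Summit.CriticalPhenomena.CardyFormulaZ2.Theorems.IKQuarterTurn
  (measurePreserving_relabel measurePreserving_compl_int measurePreserving_complEquiv_site cnt mem_Ico_min_max
    xor_left_comm' xor_not_xor_not mem_relabel_neg)

namespace MirrorBasics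

/-! ## Coordinates of the reflections -/

/-- First coordinate of `reflCell v`. -/
@[simp] theorem reflCell_apply_zero (v : Site 2) : reflCell v 0 = v 0 := rfl

/-- Second coordinate of `reflCell v`. -/
@[simp] theorem reflCell_apply_one (v : Site 2) : reflCell v 1 = -(v 1) := rfl

/-- `reflCell` is its own inverse. -/
@[simp] theorem reflCell_symm : reflCell.symm = reflCell := rfl

/-- First coordinate of `reflFace f`. -/
@[simp] theorem reflFace_apply_zero (f : Site 2) : reflFace f 0 = f 0 := rfl

/-- Second coordinate of `reflFace f`. -/
@[simp] theorem reflFace_apply_one (f : Site 2) : reflFace f 1 = -1 - f 1 := rfl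

/-- `reflFace` is its own inverse. -/
@[simp] theorem reflFace_symm : reflFace.symm = reflFace := rfl

/-! ## (a) Measure preservation -/

/-- `Θ₀` is `A ×` the rest map. -/
theorem Θ₀_eq (ω : Ω) : Θ₀ ω = (ω.1, θrest ω.2) := rfl

/-- The rest map in coordinates. -/
theorem θrest_apply (r : Set ℤ × (Set (Site 2) × (Set (Site 2) × Set (Site 2)))) :
    θrest r = (SiteConfig.relabel (Equiv.neg ℤ) r.1, SiteConfig.relabel reflFace r.2.1,
      SiteConfig.relabel reflFace r.2.2.1, (SiteConfig.relabel reflFace r.2.2.2)ᶜ) := rfl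

/-- The rest map preserves the law of the four non-`A` factors. -/
theorem measurePreserving_θrest :
    MeasurePreserving θrest
      ((sitePercolation ℤ half).prod
        ((sitePercolation (Site 2) (Set.projIcc (0:ℝ) 1 zero_le_one (2 * Real.sqrt 3 - 3))).prod
          ((sitePercolation (Site 2) half).prod (sitePercolation (Site 2) half))))
      ((sitePercolation ℤ half).prod
        ((sitePercolation (Site 2) (Set.projIcc (0:ℝ) 1 zero_le_one (2 * Real.sqrt 3 - 3))).prod
          ((sitePercolation (Site 2) half).prod (sitePercolation (Site 2) half)))) := by
  refine (measurePreserving_relabel (Equiv.neg ℤ) half).prod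
    ((measurePreserving_relabel reflFace _).prod ((measurePreserving_relabel reflFace half).prod ?_))
  exact measurePreserving_complEquiv_site.comp (measurePreserving_relabel reflFace half)

/-- **(a) `Θ₀` preserves the gauge measure.** -/
theorem measurePreserving_Θ₀ : MeasurePreserving Θ₀ μIK μIK := by
  have h : Θ₀ = fun ω : Ω => (ω.1, θrest ω.2) := funext Θ₀_eq
  rw [h]
  unfold μIK
  exact (MeasurePreserving.id _).prod measurePreserving_θrest

/-- The colour flip `B ↦ Bᶜ` preserves the gauge measure. -/
theorem measurePreserving_flipB : MeasurePreserving (fun ω : Ω => (ω.1, ω.2.1ᶜ, ω.2.2)) μIK μIK := by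
  unfold μIK
  exact (MeasurePreserving.id _).prod (measurePreserving_compl_int.prod (MeasurePreserving.id _))

/-- **(a') `Φ₀` preserves the gauge measure.** -/
theorem measurePreserving_Φ₀ : MeasurePreserving Φ₀ μIK μIK :=
  measurePreserving_Θ₀.comp measurePreserving_flipB

/-! ## (b) The colours are reflected, for every pattern `S` -/

/-- The plaquette-parity set after `Θ₀`: reflected faces (the pattern reads columns only). -/
theorem mem_parSet_Θ₀ (S : Set ℤ) (ω : Ω) (f : Site 2) : f ∈ parSet S (Θ₀ ω) ↔ reflFace f ∈ parSet S ω := by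
  simp only [parSet, Θ₀, Set.mem_setOf_eq, SiteConfig.mem_relabel_iff, reflFace_symm, reflFace_apply_zero]

/-- The plaquette-parity set after `Θ₀`, as a preimage. -/
theorem parSet_Θ₀ (S : Set ℤ) (ω : Ω) : parSet S (Θ₀ ω) = reflFace ⁻¹' parSet S ω :=
  Set.ext fun f => mem_parSet_Θ₀ S ω f

/-- The plaquette count of the row-reflected marking in the rectangle to `(a, b)` is the count of the marking in
the rectangle to `(a, -b)`. -/
theorem cnt_preimage_reflFace (P : Set (Site 2)) (a b : ℤ) : cnt (reflFace ⁻¹' P) a b = cnt P a (-b) := by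
  unfold cnt
  refine Finset.card_equiv rowFlip fun f => ?_
  simp only [Finset.mem_filter, Finset.mem_product, mem_Ico_min_max, mem_preimage, rowFlip, Equiv.coe_fn_mk]
  have hf : reflFace ![f.1, f.2] = ![f.1, -1 - f.2] := by
    ext i; fin_cases i <;> simp
  rw [hf]
  constructor
  · rintro ⟨⟨h1, h2⟩, h3⟩; exact ⟨⟨h1, by omega⟩, h3⟩
  · rintro ⟨⟨h1, h2⟩, h3⟩; exact ⟨⟨h1, by omega⟩, h3⟩

/-- Black cells through `cnt` (every `S`). -/
theorem mem_blackSet_iff_cnt (S : Set ℤ) (ω : Ω) (v : Site 2) :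
    v ∈ blackSet S ω ↔ Xor (v 0 ∈ ω.1) (Xor (v 1 ∈ ω.2.1) (Odd (cnt (parSet S ω) (v 0) (v 1)))) := by
  simp only [blackSet, mem_setOf_eq, cnt]

/-- **(b) BLACK CELLS ARE REFLECTED** (every `S`): `v` is black after `Θ₀` iff `reflCell v = (v₀, -v₁)` was black. -/
theorem mem_blackSet_Θ₀ (S : Set ℤ) (ω : Ω) (v : Site 2) :
    v ∈ blackSet S (Θ₀ ω) ↔ reflCell v ∈ blackSet S ω := by
  rw [mem_blackSet_iff_cnt, mem_blackSet_iff_cnt, parSet_Θ₀, cnt_preimage_reflFace]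
  simp only [reflCell_apply_zero, reflCell_apply_one]
  show Xor (v 0 ∈ ω.1) (Xor (v 1 ∈ SiteConfig.relabel (Equiv.neg ℤ) ω.2.1) _) ↔ _
  rw [mem_relabel_neg]

/-- The black set after `Θ₀`, as a preimage. -/
theorem blackSet_Θ₀ (S : Set ℤ) (ω : Ω) : blackSet S (Θ₀ ω) = reflCell ⁻¹' blackSet S ω :=
  Set.ext fun v => mem_blackSet_Θ₀ S ω v

/-- **(b') ANTI-DIAGONAL FLAGS after `Θ₀`** (every `S`): forced off `S`; on `S`, the reflected coin complemented. -/
theorem mem_antiSet_Θ₀ (S : Set ℤ) (ω : Ω) (f : Site 2) :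
    f ∈ antiSet S (Θ₀ ω) ↔ f 0 ∉ S ∨ reflFace f ∉ ω.2.2.2.2 := by
  simp only [antiSet, Θ₀, mem_setOf_eq, mem_compl_iff, SiteConfig.mem_relabel_iff, reflFace_symm]

/-! ## (c) The isotropic reading: `obs univ ∘ Θ₀ = reflObs ∘ obs univ` -/

/-- At `S = univ` the anti-diagonal flags after `Θ₀` are the complemented reflected flags. -/
theorem antiSet_univ_Θ₀ (ω : Ω) : antiSet Set.univ (Θ₀ ω) = (reflFace ⁻¹' antiSet Set.univ ω)ᶜ := by
  ext f
  rw [mem_antiSet_Θ₀]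
  simp only [antiSet, mem_univ, not_true_eq_false, false_or, mem_compl_iff, mem_preimage, mem_setOf_eq]

/-- **(c)** the observables after `Θ₀` (isotropic pattern): reflected colours, reflected-and-flipped diagonals. -/
theorem obs_univ_Θ₀ (ω : Ω) : obs Set.univ (Θ₀ ω) = reflObs (obs Set.univ ω) :=
  Prod.ext (blackSet_Θ₀ Set.univ ω) (antiSet_univ_Θ₀ ω)

/-! ## (d) The colour flip and `Φ₀` -/

/-- Complementing the row signs complements the colours (every `S`). -/
theorem mem_blackSet_flipB (S : Set ℤ) (ω : Ω) (v : Site 2) :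
    v ∈ blackSet S ((ω.1, ω.2.1ᶜ, ω.2.2) : Ω) ↔ v ∉ blackSet S ω := by
  rw [mem_blackSet_iff_cnt, mem_blackSet_iff_cnt]
  have hpar : parSet S ((ω.1, ω.2.1ᶜ, ω.2.2) : Ω) = parSet S ω := rfl
  rw [hpar]
  simp only [mem_compl_iff, xor_def]
  tauto

/-- The anti-diagonal flags do not read the row signs. -/
theorem antiSet_flipB (S : Set ℤ) (ω : Ω) : antiSet S ((ω.1, ω.2.1ᶜ, ω.2.2) : Ω) = antiSet S ω := rfl

/-- The observables after the colour flip (every `S`). -/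
theorem obs_flipB (S : Set ℤ) (ω : Ω) : obs S ((ω.1, ω.2.1ᶜ, ω.2.2) : Ω) = complObs (obs S ω) :=
  Prod.ext (Set.ext fun v => mem_blackSet_flipB S ω v) (antiSet_flipB S ω)

/-- **(d)** the observables after `Φ₀` (isotropic pattern). -/
theorem obs_univ_Φ₀ (ω : Ω) : obs Set.univ (Φ₀ ω) = reflObs (complObs (obs Set.univ ω)) := by
  rw [Φ₀, obs_univ_Θ₀, obs_flipB]

/-- `Φ₀` reflects the colours and complements them, for every `S`. -/
theorem mem_blackSet_Φ₀ (S : Set ℤ) (ω : Ω) (v : Site 2) :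
    v ∈ blackSet S (Φ₀ ω) ↔ reflCell v ∉ blackSet S ω := by
  rw [Φ₀, mem_blackSet_Θ₀, mem_blackSet_flipB]

end MirrorBasics

/-- **Registered sub-goal `mirror_basics`** = `Mirror` parts (a)–(d): `Θ₀`, `Φ₀` preserve `μIK`; at `S = univ` they act on the
observables by `reflObs`, resp. `reflObs ∘ complObs`. -/
theorem mirror_basics : MeasureTheory.MeasurePreserving Θ₀ μIK μIK ∧ MeasureTheory.MeasurePreserving Φ₀ μIK μIK ∧
    (∀ ω, obs Set.univ (Θ₀ ω) = reflObs (obs Set.univ ω)) ∧ (∀ ω, obs Set.univ (Φ₀ ω) = reflObs (complObs (obs Set.univ ω))) :=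
  ⟨MirrorBasics.measurePreserving_Θ₀, MirrorBasics.measurePreserving_Φ₀, MirrorBasics.obs_univ_Θ₀, MirrorBasics.obs_univ_Φ₀⟩

end Summit.CriticalPhenomena.CardyFormulaZ2.Cruxes.IKMixedBoxCrossing.PairedMirrorExploration

end
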